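import Mathlib
import Literature.Analysis.FluidPDE.Tao2016AveragedNS.ShiftSetCascadeFlows
import Summits.NavierStokesRegularity.NavierStokesRegularity.Theorems.TaoLadderRungTwoFlatCertificateGlueMeshOn
import HarnessLib

/-!
# Certificate glue on a shift set `𝕊`, XI: THE FIRST-ORDER PICARD STEP TEST — a one-step certificate
  `StepCert` from finitely many BOX INEQUALITIES (helper for item stmt-NavierStokesRegularity-22987
  `FlatGapCertificatesV2`, crux K_A♭ of route TaoLadderRungTwoFlat; cell harvest/h2-tao-ladder, p1 g14)

The mesh layer (glue X, `StepCert` / `htrap_of_mesh` / `hland_of_mesh`) reduces the dynamical clauses of the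
A♭ window certificate to ONE-STEP enclosures. This module discharges a one-step enclosure by the classical
first-order inclusion test of validated integration («rough enclosure + Picard refinement», Moore 1966 /
Lohner 1987, C⁰ part only), entirely in terms of REAL BOX INEQUALITIES:

* `InBoxOn` — window box membership; `FieldRangeOn lo hi dlo dhi` — over the window box `[lo, hi]` and all
  admissible edge inputs the window field `quadTermOn 𝕊 ε₀ α` takes values in `[dlo, dhi]` componentwise
  (an interval-arithmetic fact about an explicit polynomial: the checker's job);
* `sub_mem_mul_of_deriv_mem` — scalar mean-value enclosure `f u − f 0 ∈ u·[dlo, dhi]`;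
* `picard_level` — if a run lies in the box `[lo, hi]` on `[0,s]` then it lies in `N + [0,s]·[dlo, dhi]`;
* `stepCert_of_picard` — node box `N`, refinement levels `lo r, hi r` (`r ≤ R`, level `0` ⊇ the a priori
  `M`-box), ranges `dlo r, dhi r` with `N + [0,h]·[dlo r, dhi r] ⊆ [lo (r+1), hi (r+1)]`, hull ⊇ level `R`,
  next node ⊇ `N + h·[dlo R, dhi R]` ⇒ `StepCert`. No topology (no first-exit argument) is needed: the a
  priori `M`-box of the glue's clauses is level `0`.

First-order box propagation wraps (no contraction can be certified for a fat box over a whole hop); it is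
the kernel-complete BASE CASE of the certificate pipeline (toy certificates, short transients), the strong
one-step certificates being Taylor models with frames (the tree's `TaylorChain` format, to be ported to `𝕊`).

HONEST FRAMING: Tao-type MODEL lattices (Tao 2016 §4/§6 vocabulary, shift-set parametrised); every box
inequality is a HYPOTHESIS — nothing is computed or certified here, no stub is closed, and nothing here is a
statement about the Navier–Stokes equations.
-/

noncomputable section

-- the sub-problem namespace repeats the summit name by design (D-0017)
set_option linter.dupNamespace false

namespace Summit.NavierStokesRegularity.NavierStokesRegularity.Theorems

open Set Filter Topology Literature.Analysis.FluidPDE Literature.Analysis.FluidPDE.TaoCascade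

namespace CertificateGlueOn

variable {m : ℕ}

/-! ### Boxes and field ranges -/

/-- Membership of the WINDOW coordinates of a state in the box `[lo, hi]`.
[cite: MooreKearfottCloud2009, §2.2 (interval vectors); cell certificate format, box layer] -/
def InBoxOn (Kb Ka : ℤ) (lo hi y : Fin m → ℤ → ℝ) : Prop :=
  ∀ i k, -Kb ≤ k → k ≤ Ka → lo i k ≤ y i k ∧ y i k ≤ hi i k

/-- **FIELD RANGE ENCLOSURE**: for every state whose window part lies in the box `[lo, hi]` and whose edge
shells `-Kb-1`, `Ka+1` are admissible inputs (bounded by `Eb`, `Et`), the window field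
`quadTermOn 𝕊 ε₀ α` lies in `[dlo, dhi]` componentwise on the window (for a nearest-neighbour `𝕊` the field at
a window shell reads only the shells `k-1, k, k+1`, so this is a statement about an explicit polynomial on a
box — the interval evaluation a checker performs). [cite: MooreKearfottCloud2009, §6.2–6.4 (interval enclosures of ranges); cell certificate format, box layer] -/
def FieldRangeOn (𝕊 : Finset (ℤ × ℤ × ℤ)) (ε₀ : ℝ) (α : Fin m → Fin m → Fin m → ℤ × ℤ × ℤ → ℝ)
    (Kb Ka : ℤ) (Eb Et : ℝ) (lo hi dlo dhi : Fin m → ℤ → ℝ) : Prop :=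
  ∀ Y : Fin m → ℤ → ℝ, InBoxOn Kb Ka lo hi Y → (∀ i, |Y i (-Kb - 1)| ≤ Eb) → (∀ i, |Y i (Ka + 1)| ≤ Et) →
    ∀ i k, -Kb ≤ k → k ≤ Ka →
      dlo i k ≤ quadTermOn 𝕊 ε₀ α (fun j n _ => Y j n) i k 0 ∧
        quadTermOn 𝕊 ε₀ α (fun j n _ => Y j n) i k 0 ≤ dhi i k

/-- The field of a family at time `u` is the field of its slice (the nonlinearity is evaluated pointwise in
time). [cite: Tao2016AveragedNS, §4 (4.8); cell vocabulary] -/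
theorem quadTermOn_slice (𝕊 : Finset (ℤ × ℤ × ℤ)) (ε₀ : ℝ) (α : Fin m → Fin m → Fin m → ℤ × ℤ × ℤ → ℝ)
    (S : Fin m → ℤ → ℝ → ℝ) (i : Fin m) (k : ℤ) (u : ℝ) :
    quadTermOn 𝕊 ε₀ α (fun j n _ => slice S u j n) i k 0 = quadTermOn 𝕊 ε₀ α S i k u := rfl

/-! ### The scalar mean-value enclosure -/

/-- **Mean-value enclosure**: a function with derivative within `[0,s]` in `[dlo, dhi]` satisfies
`u·dlo ≤ f u − f 0 ≤ u·dhi` on `[0,s]`. [folklore] -/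
theorem sub_mem_mul_of_deriv_mem {f f' : ℝ → ℝ} {s dlo dhi : ℝ}
    (hf : ∀ x ∈ Icc 0 s, HasDerivWithinAt f (f' x) (Icc 0 s) x)
    (hb : ∀ x ∈ Ico 0 s, dlo ≤ f' x ∧ f' x ≤ dhi) :
    ∀ u ∈ Icc 0 s, u * dlo ≤ f u - f 0 ∧ f u - f 0 ≤ u * dhi := by
  intro u hu
  set mid : ℝ := (dlo + dhi) / 2 with hmid
  set C : ℝ := (dhi - dlo) / 2 with hC
  have hg : ∀ x ∈ Icc 0 s, HasDerivWithinAt (fun x => f x - mid * x) (f' x - mid) (Icc 0 s) x :=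
    fun x hx => (hf x hx).sub ((hasDerivWithinAt_id x _).const_mul mid |>.congr_deriv (by simp))
  have hbound : ∀ x ∈ Ico 0 s, ‖f' x - mid‖ ≤ C := by
    intro x hx
    obtain ⟨h1, h2⟩ := hb x hx
    rw [Real.norm_eq_abs, abs_le, hmid, hC]
    constructor <;> linarith
  have h := norm_image_sub_le_of_norm_deriv_le_segment' hg hbound u hu
  rw [Real.norm_eq_abs, abs_le] at h
  simp only [mul_zero, sub_zero] at h
  obtain ⟨h1, h2⟩ := h
  rw [hmid, hC] at h1 h2
  constructor <;> nlinarith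

/-! ### One Picard refinement level -/

variable {𝕊 : Finset (ℤ × ℤ × ℤ)} {ε₀ : ℝ} {α : Fin m → Fin m → Fin m → ℤ × ℤ × ℤ → ℝ} {Kb Ka : ℤ}
  {Eb Et : ℝ}

/-- **One Picard refinement level**: a window run on `[0,s]` that lies in the box `[lo, hi]` throughout, with
field range `[dlo, dhi]` over that box, satisfies `u·dlo ≤ S(u) − S(0) ≤ u·dhi` componentwise on the window.
[cite: MooreKearfottCloud2009, §9–10 (interval enclosure of ODE solutions: rough enclosure and refinement); cell certificate format, box layer] -/
theorem picard_level {s : ℝ} {S : Fin m → ℤ → ℝ → ℝ} (hrun : WindowRun 𝕊 ε₀ α Kb Ka Eb Et s S)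
    {lo hi dlo dhi : Fin m → ℤ → ℝ} (hrange : FieldRangeOn 𝕊 ε₀ α Kb Ka Eb Et lo hi dlo dhi)
    (hin : ∀ u ∈ Icc 0 s, InBoxOn Kb Ka lo hi (slice S u)) :
    ∀ i k, -Kb ≤ k → k ≤ Ka → ∀ u ∈ Icc 0 s,
      u * dlo i k ≤ S i k u - S i k 0 ∧ S i k u - S i k 0 ≤ u * dhi i k := by
  intro i k hk1 hk2
  refine sub_mem_mul_of_deriv_mem (f' := fun x => quadTermOn 𝕊 ε₀ α S i k x) (hrun.deriv i k hk1 hk2) ?_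
  intro x hx
  have hx' : x ∈ Icc 0 s := Ico_subset_Icc_self hx
  have h := hrange (slice S x) (hin x hx') (fun i' => by simpa [slice] using hrun.bound_bot i' x hx')
    (fun i' => by simpa [slice] using hrun.bound_top i' x hx') i k hk1 hk2
  rwa [quadTermOn_slice] at h

/-! ### The step test -/

/-- For `0 ≤ u ≤ h` and `d ∈ [dlo, dhi]`-type bounds: `min 0 (h·dlo) ≤ u·dlo` and `u·dhi ≤ max 0 (h·dhi)`.
[folklore] -/
theorem mul_mem_hull {u h dlo dhi : ℝ} (hu0 : 0 ≤ u) (huh : u ≤ h) :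
    min 0 (h * dlo) ≤ u * dlo ∧ u * dhi ≤ max 0 (h * dhi) := by
  constructor
  · rcases le_or_gt 0 dlo with hd | hd
    · exact (min_le_left _ _).trans (mul_nonneg hu0 hd)
    · exact (min_le_right _ _).trans (by nlinarith)
  · rcases le_or_gt 0 dhi with hd | hd
    · exact le_trans (by nlinarith) (le_max_right _ _)
    · exact le_trans (by nlinarith) (le_max_left _ _)

/-- **THE FIRST-ORDER PICARD STEP TEST ⇒ `StepCert`** (see the module docstring): node box `[Nlo, Nhi]` for
`Node j`, refinement levels `[lo r, hi r]` (`r ≤ R`; level `0` contains the a priori `M`-box), field ranges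
`[dlo r, dhi r]` over level `r` with `N + [0,h]·[dlo r, dhi r] ⊆ [lo (r+1), hi (r+1)]` (`h` = the step), the hull
of step `j` containing level `R`, and the node box of step `j+1` containing `N + h·[dlo R, dhi R]`.
[cite: MooreKearfottCloud2009, §9–10 (interval enclosure of ODE solutions: rough enclosure and refinement); cell certificate format, box layer] -/
theorem stepCert_of_picard {M : ℤ → ℝ} {t : ℕ → ℝ} {Node Hull : ℕ → (Fin m → ℤ → ℝ) → Prop} {j R : ℕ}
    {Nlo Nhi Nlo' Nhi' : Fin m → ℤ → ℝ} {lo hi dlo dhi : ℕ → Fin m → ℤ → ℝ}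
    (hN : ∀ y, Node j y → InBoxOn Kb Ka Nlo Nhi y)
    (hlvl0 : ∀ i k, -Kb ≤ k → k ≤ Ka → lo 0 i k ≤ -M k ∧ M k ≤ hi 0 i k)
    (hrange : ∀ r, r ≤ R → FieldRangeOn 𝕊 ε₀ α Kb Ka Eb Et (lo r) (hi r) (dlo r) (dhi r))
    (hincl : ∀ r, r < R → ∀ i k, -Kb ≤ k → k ≤ Ka →
      lo (r + 1) i k ≤ Nlo i k + min 0 ((t (j + 1) - t j) * dlo r i k) ∧
        Nhi i k + max 0 ((t (j + 1) - t j) * dhi r i k) ≤ hi (r + 1) i k)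
    (hH : ∀ y, InBoxOn Kb Ka (lo R) (hi R) y → Hull j y)
    (hnext : ∀ i k, -Kb ≤ k → k ≤ Ka →
      Nlo' i k ≤ Nlo i k + (t (j + 1) - t j) * dlo R i k ∧
        Nhi i k + (t (j + 1) - t j) * dhi R i k ≤ Nhi' i k)
    (hN' : ∀ y, InBoxOn Kb Ka Nlo' Nhi' y → Node (j + 1) y) :
    StepCert 𝕊 ε₀ α Kb Ka Eb Et M t Node Hull j := by
  intro s S hs hsh hnode hrun hM
  have hbox0 := hN _ hnode
  -- every refinement level holds on `[0, s]`
  have hlev : ∀ r, r ≤ R → ∀ u ∈ Icc 0 s, InBoxOn Kb Ka (lo r) (hi r) (slice S u) := by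
    intro r hr
    induction r with
    | zero =>
      intro u hu i k hk1 hk2
      have hb := abs_le.mp (hM i k hk1 hk2 u hu)
      have h0 := hlvl0 i k hk1 hk2
      simp only [slice_apply]
      exact ⟨h0.1.trans hb.1, hb.2.trans h0.2⟩
    | succ r ih =>
      intro u hu i k hk1 hk2
      have hmv := picard_level hrun (hrange r (by omega)) (ih (by omega)) i k hk1 hk2 u hu
      have hn := hbox0 i k hk1 hk2
      have hi' := hincl r (by omega) i k hk1 hk2
      have hh := mul_mem_hull (dlo := dlo r i k) (dhi := dhi r i k) hu.1 (hu.2.trans hsh)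
      simp only [slice_apply] at hn ⊢
      constructor <;> linarith [hmv.1, hmv.2, hh.1, hh.2, hi'.1, hi'.2, hn.1, hn.2]
  refine ⟨fun u hu => hH _ (hlev R le_rfl u hu), fun hsfull => hN' _ fun i k hk1 hk2 => ?_⟩
  have hmv := picard_level hrun (hrange R le_rfl) (hlev R le_rfl) i k hk1 hk2 s ⟨hs.le, le_rfl⟩
  have hn := hbox0 i k hk1 hk2
  have hx := hnext i k hk1 hk2
  have e1 : (t (j + 1) - t j) * dlo R i k = s * dlo R i k := by rw [hsfull]
  have e2 : (t (j + 1) - t j) * dhi R i k = s * dhi R i k := by rw [hsfull]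
  simp only [slice_apply] at hn ⊢
  constructor <;> linarith [hmv.1, hmv.2, hx.1, hx.2, hn.1, hn.2, e1, e2]

end CertificateGlueOn

end Summit.NavierStokesRegularity.NavierStokesRegularity.Theorems

end
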